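import Mathlib
import HarnessLib

/-!
# QUANT lane R8, T-DEC, leg (III), blob case — `LawDec.GatedSliceMixLaw'`, Q-alone side: the SCALAR INEQUALITIES of the top-open cell (class `mM`:
# the top `K = k₂ > t` is open to the zero) with a HEAVY top — the surplus inequality J1 of the twin-closed sub-cell and the resulting offer inequality

builds on p205010 (kernel theorem, internal audit signed; external expert review pending)

Support file (`--supports stmt-CriticalPhenomena-4575`), QUANT lane seat prim-quant-arm-1 (gen 41), rung R8 of
`run/shared/lean/prim/quant/LADDER.md`.  Pure real-arithmetic lemmas (theorems only, standard axioms, no sorries), consumed by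
`…QuantGatedSliceMixLawQTopOpen`; companions of `…QTwinOpenIneq` (whose `twinOpen_I2_open` / `twinOpen_beta_open` serve the twin-open sub-cell verbatim,
their hypotheses not using `K ≤ t`).  Notation as there: `W = t − 2k₁`, `A, B, C, D` the masses of `Q` at `k₁, k₁+a, K, K+a`, mean identity
`t·z = −(t−k₁)A − (t−P)B − (t−K)C + (G−t)D`, `capK·W = C(K+k₁−t)`.  Memo `run/shared/lean/prim/quant/prim-quant-arm-1-g41/Q-ALONE-G41.md` §4b
(J1 verified universal in the cell: 63 214 / 63 214 exact instances).  RATE class log\* / honest sentence unchanged.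

[this work].  Nothing here is cited as a published result.  The gluing rows served [cite: KozmaNitzan2024, Conjecture 3 (p. 15)].
-/

namespace Summit.CriticalPhenomena.PercolationContinuityZ3.Theorems

namespace Quant

namespace LawDec

/-- **J1 (twin closed, top heavy-open, ANY top above or below `t`): `(1−λ)(1−2g)W ≤ λ(1−g)(2K − t)`** from the mean identity, `T ≥ S`, `k₁ + a ≤ t`:
trivial for `g ≥ 1/2`; else `λ(2K−t) = 2T − 2(1−λ)k₁ − λt` and `t(1−gλ) ≥ (k₁+a)(1−gλ) ≥ 2(1−g)(1−z)ag + 2g(1−λ)k₁`. [this work] -/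
theorem topOpen_J1 (z g S t lam k₁ K a : ℝ) (hz0 : 0 ≤ z) (hz1 : z < 1) (hg0 : 0 < g) (hg1 : g ≤ 1) (hlam0 : 0 ≤ lam) (hlam1 : lam ≤ 1)
    (hk₁ : 0 ≤ k₁) (ha : 0 ≤ a) (hmean : (1 - z) * (k₁ + (K - k₁) * lam) = S) (ht : t = S + a * g * (1 - z))
    (hPt : k₁ + a ≤ t) (hKmid : t ≤ 2 * K) (hkK : k₁ < K) (hlow : 2 * k₁ < t) :
    (1 - lam) * (1 - 2 * g) * (t - 2 * k₁) ≤ lam * (1 - g) * (2 * K - t) := by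
  have hW : 0 ≤ t - 2 * k₁ := by linarith
  by_cases hg : 1 / 2 ≤ g
  · have h1 : (1 - lam) * (1 - 2 * g) * (t - 2 * k₁) ≤ 0 :=
      mul_nonpos_of_nonpos_of_nonneg (mul_nonpos_of_nonneg_of_nonpos (by linarith) (by linarith)) hW
    have h2 : 0 ≤ lam * (1 - g) * (2 * K - t) := mul_nonneg (mul_nonneg hlam0 (by linarith)) (by linarith)
    linarith
  · have hg' : g < 1 / 2 := not_le.1 hg
    have h1z : 0 < 1 - z := by linarith
    have e : lam * (2 * K - t) = 2 * (S / (1 - z) - k₁) + 2 * lam * k₁ - lam * t := by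
      have : lam * (K - k₁) = S / (1 - z) - k₁ := by
        field_simp
        linarith [hmean]
      linarith [this]
    have hS0 : 0 ≤ S := by rw [← hmean]; exact mul_nonneg h1z.le (by nlinarith)
    have hT : S ≤ S / (1 - z) := by
      rw [le_div_iff₀ h1z]; nlinarith
    -- RHS − LHS ≥ t(1−gλ) − 2(1−g)(1−z)ag − 2g(1−λ)k₁ ≥ 0
    have key : lam * (1 - g) * (2 * K - t) - (1 - lam) * (1 - 2 * g) * (t - 2 * k₁)
        ≥ t * (1 - g * lam) - 2 * (1 - g) * (1 - z) * a * g - 2 * g * (1 - lam) * k₁ := by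
      rw [mul_assoc lam (1 - g), mul_comm (1 - g) (2 * K - t), ← mul_assoc, e]
      nlinarith [mul_le_mul_of_nonneg_left hT (by linarith : (0:ℝ) ≤ 1 - g)]
    have h3 : 0 ≤ t * (1 - g * lam) - 2 * (1 - g) * (1 - z) * a * g - 2 * g * (1 - lam) * k₁ := by
      have hgl : 0 ≤ 1 - g * lam := by nlinarith
      have h4 : (k₁ + a) * (1 - g * lam) ≤ t * (1 - g * lam) := mul_le_mul_of_nonneg_right hPt hgl
      -- a-part: 1 − gλ ≥ 2(1−g)(1−z)g ; k₁-part: 1 − gλ ≥ 2g(1−λ)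
      have ha' : 2 * (1 - g) * (1 - z) * g ≤ 1 - g * lam := by nlinarith [mul_nonneg hz0 hg0.le, mul_nonneg hg0.le hlam0]
      have hk' : 2 * g * (1 - lam) ≤ 1 - g * lam := by nlinarith
      nlinarith [mul_le_mul_of_nonneg_left ha' ha, mul_le_mul_of_nonneg_left hk' hk₁]
    linarith

/-- **offer inequality, twin CLOSED (`2k₁ + a ≤ t`), heavy top SATURATED**: `y(z + (A − capK)) ≤ (1−y)D ⟸ J1` in the form
`A·W ≤ B·W + C(2K − t)` (`capK·W = C(K + k₁ − t)`; the top may lie above `t`). [this work] -/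
theorem topOpen_beta_closedTwin (t y k₁ K a A B C D z capK W : ℝ) (hy0 : 0 < y) (ht0 : 0 < t) (hk₁0 : 0 ≤ k₁) (hW : W = t - 2 * k₁)
    (hW0 : 0 < W) (htz : t * z = -((t - k₁) * A) - (t - (k₁ + a)) * B - (t - K) * C + (K + a - t) * D)
    (hyG : y * (K + a) ≤ t) (hP : 2 * k₁ + a ≤ t) (hB0 : 0 ≤ B) (hD0 : 0 ≤ D)
    (hcap : capK * W = C * (K + k₁ - t)) (hJ1 : A * W ≤ B * W + C * (2 * K - t)) :
    y * (z + (A - capK)) ≤ (1 - y) * D := by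
  have e1 : t * (z + (A - capK)) * W
      = (k₁ * A - (t - (k₁ + a)) * B + (K + a - t) * D) * W - k₁ * (2 * K - t) * C := by
    rw [hW] at hcap ⊢
    linear_combination (t - 2 * k₁) * htz - t * hcap
  have hb : k₁ * B ≤ (t - (k₁ + a)) * B := mul_le_mul_of_nonneg_right (by linarith) hB0
  have hGD : (K + a - t) * D * y ≤ (t - t * y) * D := by nlinarith [mul_le_mul_of_nonneg_right hyG hD0]
  have hk : k₁ * (A * W - B * W - C * (2 * K - t)) ≤ 0 := mul_nonpos_of_nonneg_of_nonpos hk₁0 (by linarith)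
  have h2 : y * (t * (z + (A - capK)) * W) ≤ (t - t * y) * D * W := by
    rw [e1]
    nlinarith [mul_le_mul_of_nonneg_right hGD hW0.le, mul_le_mul_of_nonneg_right (mul_le_mul_of_nonneg_left hb hy0.le) hW0.le,
      mul_le_mul_of_nonneg_left hk hy0.le]
  have h3 : (t * W) * (y * (z + (A - capK))) ≤ (t * W) * ((1 - y) * D) := by
    have e2 : (t * W) * (y * (z + (A - capK))) = y * (t * (z + (A - capK)) * W) := by ring
    have e3 : (t * W) * ((1 - y) * D) = (t - t * y) * D * W := by ring
    rw [e2, e3]; exact h2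
  exact le_of_mul_le_mul_left h3 (mul_pos ht0 hW0)

end LawDec

end Quant

end Summit.CriticalPhenomena.PercolationContinuityZ3.Theorems
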